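import Summits.AtomisticToContinuum.HydrodynamicLimit.Theorems.RelayRaceLocalityNearConstantShortTimeHLEndgameTL
import HarnessLib

/-!
# Crux `NearConstantShortTimeHL` (stmt-AtomisticToContinuum-12502) — ROUTE-LEVEL SPLIT GLUE for the v25 "TL" residue (TRUE-LAW inputs only):
# `NearConstantShortTimeHL` ⇐ {TrueLawMomentumClosure, TrueLawEnergyClosure, TrueLawCapsPE}

Support file (`--supports stmt-AtomisticToContinuum-12502`), lead prover-line-stmt-AtomisticToContinuum-12502-c10-0, line `small-tilt-domination`,
skeleton v25. WHY: after the architecture reshape of lead c10 (the equilibrium import dropped; closure inputs typed ALONG THE TRUE LAW as convergence in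
probability, `…TrueLawClosureDefs` p164768) the line is complete modulo exactly three OPEN conjectures about the true non-equilibrium law of the
hard-sphere gas started from local Gibbs data, and the tree certifies
`nearConstantShortTimeHL_of_dynamicsTL : TrueLawMomentumClosure → TrueLawEnergyClosure → TrueLawCapsPE → NearConstantShortTimeHL` (`…EndgameTL`, p167432).
For the planner to file these three as route items (`ledger route edit … --split NearConstantShortTimeHL --into children-TL.json --glue-by
…nearConstantShortTimeHL_of_subsTL`, D-0019 glued split, k = 3) the children must elaborate in the import context of `Theses/RelayRaceLocality.lean`,
which cannot import `Theorems/…`. So the three conjectures are re-stated here SELF-CONTAINED over `Literature` vocabulary — verbatim the bodies of the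
three `@[conjecture] def`s with `packCapOn` / `intExpCapOn` / `momDefect` / `enDefect` / `mesoRadius` / `ballKernel` unfolded (the pattern of
`…SplitPQ`, lead c9). The three `_inlined_iff` lemmas record that the inlined texts ARE the tree conjectures (definitional, `Iff.rfl`), and
`nearConstantShortTimeHL_of_subsTL` is the glue `Sub₁ → Sub₂ → Sub₃ → NearConstantShortTimeHL`. No new mathematics. The matching `children-TL.json`
(statements = the three antecedents below behind the crux's `open … in` prefix) is attached to the item as evidence.

* `Sub₁` = `TrueLawMomentumClosure` (S2ᵀ) — along the TRUE law from local-Gibbs data tied to a classical hs-Euler solution, pre-shock, inside the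
  packing band: for every window `[s,s+τ] ⊆ [0,t]`, normalised smooth vector test, `δ > 0`, cap level `K`,
  `P_N{ball-packing cap ∧ integrated exponential cap ∧ δ < |windowed weak-form MOMENTUM closure defect|} → 0` (local equilibrium of the momentum flux in
  probability — the one-block input of Yau 1991 §2 / Olla–Varadhan–Yau 1993 §1, §4 for deterministic hard spheres; no rate, no uniformity);
* `Sub₂` = `TrueLawEnergyClosure` (S3ᵀ) — its energy twin (scalar tests, third velocity moments + collisional transfer);
* `Sub₃` = `TrueLawCapsPE` (S4‴) — along the true law: the ball-packing cap at radius `n^{-1/4}` (twin of `NoDenseInclusions`, stmt-14425) and ALL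
  exponential velocity moments in mean at fixed times (the `HighMomentumCutoffNarrow` minimal form), pre-shock.

References: H.-T. Yau, Lett. Math. Phys. 22 (1991) §2; S. Olla – S.R.S. Varadhan – H.-T. Yau, Comm. Math. Phys. 155 (1993) §1, §4; C. Kipnis – C. Landim
(1999) Ch. 5–6; H. Spohn (1991) Part I §2.3–2.4.
-/

noncomputable section

namespace Summit.AtomisticToContinuum.HydrodynamicLimit.Theorems.NearConstantShortTimeHL

open scoped BigOperators ENNReal
open MeasureTheory Set Filter Topology
open Literature.MathematicalPhysics.KineticTheory Literature.Analysis.FluidPDE Literature.Analysis.FunctionSpaces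
open Summit.AtomisticToContinuum.HydrodynamicLimit.Theses.RelayRaceLocality (NearConstantShortTimeHL)

/-- **Sub₁ inlined = `TrueLawMomentumClosure`** (definitional unfolding of `packCapOn`, `intExpCapOn`, `momDefect`, `mesoRadius`, `ballKernel`).
[folklore] -/
theorem trueLawMomentumClosure_inlined_iff :
    (∃ η₁ : ℝ, 0 < η₁ ∧ ∀ (a₀ θ₀ : T3 → ℝ) (u₀ : T3 → V3), Continuous a₀ → Continuous θ₀ → Continuous u₀ →
        (∀ x, 0 < a₀ x) → (∀ x, 0 < θ₀ x) → ∃ σ₀ : ℝ, 0 < σ₀ ∧ ∀ σ : ℝ, 0 < σ → σ < σ₀ →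
        ∀ (ε : ℕ → ℝ) (n : ℕ → ℕ), (∀ N, 0 < ε N) → Tendsto ε atTop (nhds 0) →
        Tendsto (fun N => (n N : ℝ) * ε N ^ 3) atTop (nhds (σ ^ 3)) →
        ∀ (T : ℝ) (ρ θ : ℝ → T3 → ℝ) (u : ℝ → T3 → V3), IsHardSphereEulerSolution σ T ρ u θ →
        ∀ Φ : (N : ℕ) → HardSphereFlow (Torus.geometry (Fin 3)) (ε N) (n N),
        let P : (N : ℕ) → Measure (Config (n N) (Fin 3) T3) := fun N =>
        particleLaw (Φ N) (canonicalDensity (Torus.geometry (Fin 3)) (ε N) (n N) (localGibbsProfile a₀ u₀ θ₀));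
        (∀ N, IsProbabilityMeasure (P N)) →
        (∀ χ : T3 → ℝ, Continuous χ → ∀ δ : ℝ, 0 < δ →
        Tendsto (fun N => P N {z | δ < |empiricalDensityField ((Φ N).flow 0 z) χ - ∫ x, χ x * ρ 0 x|}) atTop (nhds 0) ∧
        Tendsto (fun N => P N {z | δ < ‖empiricalMomentumField ((Φ N).flow 0 z) χ - ∫ x, (χ x * ρ 0 x) • u 0 x‖}) atTop (nhds 0) ∧
        Tendsto (fun N => P N {z | δ < |empiricalEnergyField ((Φ N).flow 0 z) χ -
        ∫ x, χ x * totalEnergyDensity (ρ 0 x) (u 0 x) (θ 0 x)|}) atTop (nhds 0)) →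
        ∀ t ∈ Set.Ico 0 T, (∀ s ∈ Set.Icc 0 t, ∀ x, ρ s x * σ ^ 3 ≤ η₁ / 2) →
        ∀ (s τ : ℝ), 0 ≤ s → 0 < τ → s + τ ≤ t →
        ∀ ψ : ℝ → T3 → V3, Torus.IsSmoothSpaceTimeOn (Set.Icc s (s + τ)) ψ →
        (∀ r ∈ Set.Icc s (s + τ), ∀ x, ‖ψ r x‖ ≤ 1 ∧ ‖Torus.timeDerivWithin (Set.Icc s (s + τ)) ψ r x‖ ≤ 1 ∧
        ∀ i, ‖Torus.partialDeriv i (ψ r) x‖ ≤ 1) →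
        ∀ δ : ℝ, 0 < δ → ∀ K : ℝ, 0 < K →
        Tendsto (fun N => P N {z | let ℓ : ℝ := (n N : ℝ) ^ (-(1 / 4 : ℝ));
        let χ : T3 → T3 → ℝ := fun x y => if Torus.euclidDist x y < ℓ
        then (4 / 3 * Real.pi * ℓ ^ 3)⁻¹ else 0;
        let ϱ : ℝ → T3 → ℝ := fun r x => empiricalDensityField ((Φ N).flow r z) (χ x);
        let m : ℝ → T3 → V3 := fun r x => empiricalMomentumField ((Φ N).flow r z) (χ x);
        let e : ℝ → T3 → ℝ := fun r x => empiricalEnergyField ((Φ N).flow r z) (χ x);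
        let p : ℝ → T3 → ℝ := fun r x => hsPressure σ (ϱ r x) (2 / 3 * (e r x / ϱ r x - ‖m r x‖ ^ 2 / (2 * ϱ r x ^ 2)));
        let Mt : ℝ → (T3 → V3) → ℝ := fun r g => ∑ j, (empiricalMomentumField ((Φ N).flow r z) (fun y => g y j)) j;
        (∀ r ∈ Set.Icc s (s + τ), ∀ x, ϱ r x * σ ^ 3 ≤ η₁) ∧
        (∫⁻ r in Set.Icc s (s + τ), ENNReal.ofReal ((n N : ℝ)⁻¹ * ∑ i, Real.exp ‖((Φ N).flow r z i).2‖) ≤ ENNReal.ofReal K) ∧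
        δ < |Mt (s + τ) (ψ (s + τ)) - Mt s (ψ s) - ∫ r in s..(s + τ), (Mt r (Torus.timeDerivWithin (Set.Icc s (s + τ)) ψ r) +
        ∫ x, ((∑ i, ∑ j, (Torus.partialDeriv i (ψ r) x) j * (m r x i * m r x j / ϱ r x)) + p r x * Torus.divergence (ψ r) x))|}) atTop (nhds 0)) ↔ TrueLawMomentumClosure :=
  Iff.rfl

/-- **Sub₂ inlined = `TrueLawEnergyClosure`** (definitional unfolding of `packCapOn`, `intExpCapOn`, `enDefect`, `mesoRadius`, `ballKernel`).
[folklore] -/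
theorem trueLawEnergyClosure_inlined_iff :
    (∃ η₁ : ℝ, 0 < η₁ ∧ ∀ (a₀ θ₀ : T3 → ℝ) (u₀ : T3 → V3), Continuous a₀ → Continuous θ₀ → Continuous u₀ →
        (∀ x, 0 < a₀ x) → (∀ x, 0 < θ₀ x) → ∃ σ₀ : ℝ, 0 < σ₀ ∧ ∀ σ : ℝ, 0 < σ → σ < σ₀ →
        ∀ (ε : ℕ → ℝ) (n : ℕ → ℕ), (∀ N, 0 < ε N) → Tendsto ε atTop (nhds 0) →
        Tendsto (fun N => (n N : ℝ) * ε N ^ 3) atTop (nhds (σ ^ 3)) →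
        ∀ (T : ℝ) (ρ θ : ℝ → T3 → ℝ) (u : ℝ → T3 → V3), IsHardSphereEulerSolution σ T ρ u θ →
        ∀ Φ : (N : ℕ) → HardSphereFlow (Torus.geometry (Fin 3)) (ε N) (n N),
        let P : (N : ℕ) → Measure (Config (n N) (Fin 3) T3) := fun N =>
        particleLaw (Φ N) (canonicalDensity (Torus.geometry (Fin 3)) (ε N) (n N) (localGibbsProfile a₀ u₀ θ₀));
        (∀ N, IsProbabilityMeasure (P N)) →
        (∀ χ : T3 → ℝ, Continuous χ → ∀ δ : ℝ, 0 < δ →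
        Tendsto (fun N => P N {z | δ < |empiricalDensityField ((Φ N).flow 0 z) χ - ∫ x, χ x * ρ 0 x|}) atTop (nhds 0) ∧
        Tendsto (fun N => P N {z | δ < ‖empiricalMomentumField ((Φ N).flow 0 z) χ - ∫ x, (χ x * ρ 0 x) • u 0 x‖}) atTop (nhds 0) ∧
        Tendsto (fun N => P N {z | δ < |empiricalEnergyField ((Φ N).flow 0 z) χ -
        ∫ x, χ x * totalEnergyDensity (ρ 0 x) (u 0 x) (θ 0 x)|}) atTop (nhds 0)) →
        ∀ t ∈ Set.Ico 0 T, (∀ s ∈ Set.Icc 0 t, ∀ x, ρ s x * σ ^ 3 ≤ η₁ / 2) →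
        ∀ (s τ : ℝ), 0 ≤ s → 0 < τ → s + τ ≤ t →
        ∀ φ : ℝ → T3 → ℝ, Torus.IsSmoothSpaceTimeOn (Set.Icc s (s + τ)) φ →
        (∀ r ∈ Set.Icc s (s + τ), ∀ x, |φ r x| ≤ 1 ∧ |Torus.timeDerivWithin (Set.Icc s (s + τ)) φ r x| ≤ 1 ∧
        ∀ i, |Torus.partialDeriv i (φ r) x| ≤ 1) →
        ∀ δ : ℝ, 0 < δ → ∀ K : ℝ, 0 < K →
        Tendsto (fun N => P N {z | let ℓ : ℝ := (n N : ℝ) ^ (-(1 / 4 : ℝ));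
        let χ : T3 → T3 → ℝ := fun x y => if Torus.euclidDist x y < ℓ
        then (4 / 3 * Real.pi * ℓ ^ 3)⁻¹ else 0;
        let ϱ : ℝ → T3 → ℝ := fun r x => empiricalDensityField ((Φ N).flow r z) (χ x);
        let m : ℝ → T3 → V3 := fun r x => empiricalMomentumField ((Φ N).flow r z) (χ x);
        let e : ℝ → T3 → ℝ := fun r x => empiricalEnergyField ((Φ N).flow r z) (χ x);
        let p : ℝ → T3 → ℝ := fun r x => hsPressure σ (ϱ r x) (2 / 3 * (e r x / ϱ r x - ‖m r x‖ ^ 2 / (2 * ϱ r x ^ 2)));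
        let Et : ℝ → (T3 → ℝ) → ℝ := fun r g => empiricalEnergyField ((Φ N).flow r z) g;
        (∀ r ∈ Set.Icc s (s + τ), ∀ x, ϱ r x * σ ^ 3 ≤ η₁) ∧
        (∫⁻ r in Set.Icc s (s + τ), ENNReal.ofReal ((n N : ℝ)⁻¹ * ∑ i, Real.exp ‖((Φ N).flow r z i).2‖) ≤ ENNReal.ofReal K) ∧
        δ < |Et (s + τ) (φ (s + τ)) - Et s (φ s) - ∫ r in s..(s + τ), (Et r (Torus.timeDerivWithin (Set.Icc s (s + τ)) φ r) +
        ∫ x, (e r x + p r x) * (∑ i, (m r x i / ϱ r x) * (Torus.gradient (φ r) x) i))|}) atTop (nhds 0)) ↔ TrueLawEnergyClosure :=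
  Iff.rfl

/-- **Sub₃ inlined = `TrueLawCapsPE`** (syntactically the same body). [folklore] -/
theorem trueLawCapsPE_inlined_iff :
    (∀ η₁ : ℝ, 0 < η₁ → ∀ (a₀ θ₀ : T3 → ℝ) (u₀ : T3 → V3), Continuous a₀ → Continuous θ₀ → Continuous u₀ →
        (∀ x, 0 < a₀ x) → (∀ x, 0 < θ₀ x) → ∃ σ₀ : ℝ, 0 < σ₀ ∧ ∀ σ : ℝ, 0 < σ → σ < σ₀ →
        ∀ (ε : ℕ → ℝ) (n : ℕ → ℕ), (∀ N, 0 < ε N) → Tendsto ε atTop (nhds 0) →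
        Tendsto (fun N => (n N : ℝ) * ε N ^ 3) atTop (nhds (σ ^ 3)) →
        ∀ (T : ℝ) (ρ θ : ℝ → T3 → ℝ) (u : ℝ → T3 → V3), IsHardSphereEulerSolution σ T ρ u θ →
        ∀ Φ : (N : ℕ) → HardSphereFlow (Torus.geometry (Fin 3)) (ε N) (n N),
        let P : (N : ℕ) → Measure (Config (n N) (Fin 3) T3) := fun N =>
        particleLaw (Φ N) (canonicalDensity (Torus.geometry (Fin 3)) (ε N) (n N) (localGibbsProfile a₀ u₀ θ₀));
        (∀ N, IsProbabilityMeasure (P N)) →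
        (∀ χ : T3 → ℝ, Continuous χ → ∀ δ : ℝ, 0 < δ →
        Tendsto (fun N => P N {z | δ < |empiricalDensityField ((Φ N).flow 0 z) χ - ∫ x, χ x * ρ 0 x|}) atTop (nhds 0) ∧
        Tendsto (fun N => P N {z | δ < ‖empiricalMomentumField ((Φ N).flow 0 z) χ - ∫ x, (χ x * ρ 0 x) • u 0 x‖}) atTop (nhds 0) ∧
        Tendsto (fun N => P N {z | δ < |empiricalEnergyField ((Φ N).flow 0 z) χ -
        ∫ x, χ x * totalEnergyDensity (ρ 0 x) (u 0 x) (θ 0 x)|}) atTop (nhds 0)) →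
        ∀ t ∈ Set.Ico 0 T, (∀ s ∈ Set.Icc 0 t, ∀ x, ρ s x * σ ^ 3 ≤ η₁ / 2) →
        Tendsto (fun N => P N {z | ∃ r ∈ Set.Icc 0 t, ∃ x : T3,
        η₁ < empiricalDensityField ((Φ N).flow r z)
        (fun y => if Torus.euclidDist x y < (n N : ℝ) ^ (-(1 / 4 : ℝ))
        then (4 / 3 * Real.pi * ((n N : ℝ) ^ (-(1 / 4 : ℝ))) ^ 3)⁻¹ else 0) * σ ^ 3}) atTop (nhds 0) ∧
        (∀ b : ℝ, 0 < b → ∃ A : ℝ, ∀ᶠ N : ℕ in atTop, ∀ s ∈ Set.Icc 0 t,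
        ∫⁻ z, ENNReal.ofReal ((n N : ℝ)⁻¹ * ∑ i : Fin (n N), Real.exp (b * ‖((Φ N).flow s z i).2‖)) ∂(P N) ≤
        ENNReal.ofReal A)) ↔ TrueLawCapsPE :=
  Iff.rfl

/-- **ROUTE-LEVEL GLUE OF THE SPLIT (v25 residue).** The three inlined children imply the crux `RelayRaceLocality.NearConstantShortTimeHL`: the tree
theorem `nearConstantShortTimeHL_of_dynamicsTL` read through the three definitional `_inlined_iff`s. This is the `--glue-by` theorem for
`ledger route edit route-AtomisticToContinuum-RelayRaceLocality --split NearConstantShortTimeHL --into children-TL.json`. [cite: Yau1991, §2]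
[cite: OllaVaradhanYau1993, §1, §4] -/
theorem nearConstantShortTimeHL_of_subsTL :
    (∃ η₁ : ℝ, 0 < η₁ ∧ ∀ (a₀ θ₀ : T3 → ℝ) (u₀ : T3 → V3), Continuous a₀ → Continuous θ₀ → Continuous u₀ →
        (∀ x, 0 < a₀ x) → (∀ x, 0 < θ₀ x) → ∃ σ₀ : ℝ, 0 < σ₀ ∧ ∀ σ : ℝ, 0 < σ → σ < σ₀ →
        ∀ (ε : ℕ → ℝ) (n : ℕ → ℕ), (∀ N, 0 < ε N) → Tendsto ε atTop (nhds 0) →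
        Tendsto (fun N => (n N : ℝ) * ε N ^ 3) atTop (nhds (σ ^ 3)) →
        ∀ (T : ℝ) (ρ θ : ℝ → T3 → ℝ) (u : ℝ → T3 → V3), IsHardSphereEulerSolution σ T ρ u θ →
        ∀ Φ : (N : ℕ) → HardSphereFlow (Torus.geometry (Fin 3)) (ε N) (n N),
        let P : (N : ℕ) → Measure (Config (n N) (Fin 3) T3) := fun N =>
        particleLaw (Φ N) (canonicalDensity (Torus.geometry (Fin 3)) (ε N) (n N) (localGibbsProfile a₀ u₀ θ₀));
        (∀ N, IsProbabilityMeasure (P N)) →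
        (∀ χ : T3 → ℝ, Continuous χ → ∀ δ : ℝ, 0 < δ →
        Tendsto (fun N => P N {z | δ < |empiricalDensityField ((Φ N).flow 0 z) χ - ∫ x, χ x * ρ 0 x|}) atTop (nhds 0) ∧
        Tendsto (fun N => P N {z | δ < ‖empiricalMomentumField ((Φ N).flow 0 z) χ - ∫ x, (χ x * ρ 0 x) • u 0 x‖}) atTop (nhds 0) ∧
        Tendsto (fun N => P N {z | δ < |empiricalEnergyField ((Φ N).flow 0 z) χ -
        ∫ x, χ x * totalEnergyDensity (ρ 0 x) (u 0 x) (θ 0 x)|}) atTop (nhds 0)) →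
        ∀ t ∈ Set.Ico 0 T, (∀ s ∈ Set.Icc 0 t, ∀ x, ρ s x * σ ^ 3 ≤ η₁ / 2) →
        ∀ (s τ : ℝ), 0 ≤ s → 0 < τ → s + τ ≤ t →
        ∀ ψ : ℝ → T3 → V3, Torus.IsSmoothSpaceTimeOn (Set.Icc s (s + τ)) ψ →
        (∀ r ∈ Set.Icc s (s + τ), ∀ x, ‖ψ r x‖ ≤ 1 ∧ ‖Torus.timeDerivWithin (Set.Icc s (s + τ)) ψ r x‖ ≤ 1 ∧
        ∀ i, ‖Torus.partialDeriv i (ψ r) x‖ ≤ 1) →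
        ∀ δ : ℝ, 0 < δ → ∀ K : ℝ, 0 < K →
        Tendsto (fun N => P N {z | let ℓ : ℝ := (n N : ℝ) ^ (-(1 / 4 : ℝ));
        let χ : T3 → T3 → ℝ := fun x y => if Torus.euclidDist x y < ℓ
        then (4 / 3 * Real.pi * ℓ ^ 3)⁻¹ else 0;
        let ϱ : ℝ → T3 → ℝ := fun r x => empiricalDensityField ((Φ N).flow r z) (χ x);
        let m : ℝ → T3 → V3 := fun r x => empiricalMomentumField ((Φ N).flow r z) (χ x);
        let e : ℝ → T3 → ℝ := fun r x => empiricalEnergyField ((Φ N).flow r z) (χ x);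
        let p : ℝ → T3 → ℝ := fun r x => hsPressure σ (ϱ r x) (2 / 3 * (e r x / ϱ r x - ‖m r x‖ ^ 2 / (2 * ϱ r x ^ 2)));
        let Mt : ℝ → (T3 → V3) → ℝ := fun r g => ∑ j, (empiricalMomentumField ((Φ N).flow r z) (fun y => g y j)) j;
        (∀ r ∈ Set.Icc s (s + τ), ∀ x, ϱ r x * σ ^ 3 ≤ η₁) ∧
        (∫⁻ r in Set.Icc s (s + τ), ENNReal.ofReal ((n N : ℝ)⁻¹ * ∑ i, Real.exp ‖((Φ N).flow r z i).2‖) ≤ ENNReal.ofReal K) ∧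
        δ < |Mt (s + τ) (ψ (s + τ)) - Mt s (ψ s) - ∫ r in s..(s + τ), (Mt r (Torus.timeDerivWithin (Set.Icc s (s + τ)) ψ r) +
        ∫ x, ((∑ i, ∑ j, (Torus.partialDeriv i (ψ r) x) j * (m r x i * m r x j / ϱ r x)) + p r x * Torus.divergence (ψ r) x))|}) atTop (nhds 0)) →
    (∃ η₁ : ℝ, 0 < η₁ ∧ ∀ (a₀ θ₀ : T3 → ℝ) (u₀ : T3 → V3), Continuous a₀ → Continuous θ₀ → Continuous u₀ →
        (∀ x, 0 < a₀ x) → (∀ x, 0 < θ₀ x) → ∃ σ₀ : ℝ, 0 < σ₀ ∧ ∀ σ : ℝ, 0 < σ → σ < σ₀ →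
        ∀ (ε : ℕ → ℝ) (n : ℕ → ℕ), (∀ N, 0 < ε N) → Tendsto ε atTop (nhds 0) →
        Tendsto (fun N => (n N : ℝ) * ε N ^ 3) atTop (nhds (σ ^ 3)) →
        ∀ (T : ℝ) (ρ θ : ℝ → T3 → ℝ) (u : ℝ → T3 → V3), IsHardSphereEulerSolution σ T ρ u θ →
        ∀ Φ : (N : ℕ) → HardSphereFlow (Torus.geometry (Fin 3)) (ε N) (n N),
        let P : (N : ℕ) → Measure (Config (n N) (Fin 3) T3) := fun N =>
        particleLaw (Φ N) (canonicalDensity (Torus.geometry (Fin 3)) (ε N) (n N) (localGibbsProfile a₀ u₀ θ₀));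
        (∀ N, IsProbabilityMeasure (P N)) →
        (∀ χ : T3 → ℝ, Continuous χ → ∀ δ : ℝ, 0 < δ →
        Tendsto (fun N => P N {z | δ < |empiricalDensityField ((Φ N).flow 0 z) χ - ∫ x, χ x * ρ 0 x|}) atTop (nhds 0) ∧
        Tendsto (fun N => P N {z | δ < ‖empiricalMomentumField ((Φ N).flow 0 z) χ - ∫ x, (χ x * ρ 0 x) • u 0 x‖}) atTop (nhds 0) ∧
        Tendsto (fun N => P N {z | δ < |empiricalEnergyField ((Φ N).flow 0 z) χ -
        ∫ x, χ x * totalEnergyDensity (ρ 0 x) (u 0 x) (θ 0 x)|}) atTop (nhds 0)) →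
        ∀ t ∈ Set.Ico 0 T, (∀ s ∈ Set.Icc 0 t, ∀ x, ρ s x * σ ^ 3 ≤ η₁ / 2) →
        ∀ (s τ : ℝ), 0 ≤ s → 0 < τ → s + τ ≤ t →
        ∀ φ : ℝ → T3 → ℝ, Torus.IsSmoothSpaceTimeOn (Set.Icc s (s + τ)) φ →
        (∀ r ∈ Set.Icc s (s + τ), ∀ x, |φ r x| ≤ 1 ∧ |Torus.timeDerivWithin (Set.Icc s (s + τ)) φ r x| ≤ 1 ∧
        ∀ i, |Torus.partialDeriv i (φ r) x| ≤ 1) →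
        ∀ δ : ℝ, 0 < δ → ∀ K : ℝ, 0 < K →
        Tendsto (fun N => P N {z | let ℓ : ℝ := (n N : ℝ) ^ (-(1 / 4 : ℝ));
        let χ : T3 → T3 → ℝ := fun x y => if Torus.euclidDist x y < ℓ
        then (4 / 3 * Real.pi * ℓ ^ 3)⁻¹ else 0;
        let ϱ : ℝ → T3 → ℝ := fun r x => empiricalDensityField ((Φ N).flow r z) (χ x);
        let m : ℝ → T3 → V3 := fun r x => empiricalMomentumField ((Φ N).flow r z) (χ x);
        let e : ℝ → T3 → ℝ := fun r x => empiricalEnergyField ((Φ N).flow r z) (χ x);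
        let p : ℝ → T3 → ℝ := fun r x => hsPressure σ (ϱ r x) (2 / 3 * (e r x / ϱ r x - ‖m r x‖ ^ 2 / (2 * ϱ r x ^ 2)));
        let Et : ℝ → (T3 → ℝ) → ℝ := fun r g => empiricalEnergyField ((Φ N).flow r z) g;
        (∀ r ∈ Set.Icc s (s + τ), ∀ x, ϱ r x * σ ^ 3 ≤ η₁) ∧
        (∫⁻ r in Set.Icc s (s + τ), ENNReal.ofReal ((n N : ℝ)⁻¹ * ∑ i, Real.exp ‖((Φ N).flow r z i).2‖) ≤ ENNReal.ofReal K) ∧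
        δ < |Et (s + τ) (φ (s + τ)) - Et s (φ s) - ∫ r in s..(s + τ), (Et r (Torus.timeDerivWithin (Set.Icc s (s + τ)) φ r) +
        ∫ x, (e r x + p r x) * (∑ i, (m r x i / ϱ r x) * (Torus.gradient (φ r) x) i))|}) atTop (nhds 0)) →
    (∀ η₁ : ℝ, 0 < η₁ → ∀ (a₀ θ₀ : T3 → ℝ) (u₀ : T3 → V3), Continuous a₀ → Continuous θ₀ → Continuous u₀ →
        (∀ x, 0 < a₀ x) → (∀ x, 0 < θ₀ x) → ∃ σ₀ : ℝ, 0 < σ₀ ∧ ∀ σ : ℝ, 0 < σ → σ < σ₀ →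
        ∀ (ε : ℕ → ℝ) (n : ℕ → ℕ), (∀ N, 0 < ε N) → Tendsto ε atTop (nhds 0) →
        Tendsto (fun N => (n N : ℝ) * ε N ^ 3) atTop (nhds (σ ^ 3)) →
        ∀ (T : ℝ) (ρ θ : ℝ → T3 → ℝ) (u : ℝ → T3 → V3), IsHardSphereEulerSolution σ T ρ u θ →
        ∀ Φ : (N : ℕ) → HardSphereFlow (Torus.geometry (Fin 3)) (ε N) (n N),
        let P : (N : ℕ) → Measure (Config (n N) (Fin 3) T3) := fun N =>
        particleLaw (Φ N) (canonicalDensity (Torus.geometry (Fin 3)) (ε N) (n N) (localGibbsProfile a₀ u₀ θ₀));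
        (∀ N, IsProbabilityMeasure (P N)) →
        (∀ χ : T3 → ℝ, Continuous χ → ∀ δ : ℝ, 0 < δ →
        Tendsto (fun N => P N {z | δ < |empiricalDensityField ((Φ N).flow 0 z) χ - ∫ x, χ x * ρ 0 x|}) atTop (nhds 0) ∧
        Tendsto (fun N => P N {z | δ < ‖empiricalMomentumField ((Φ N).flow 0 z) χ - ∫ x, (χ x * ρ 0 x) • u 0 x‖}) atTop (nhds 0) ∧
        Tendsto (fun N => P N {z | δ < |empiricalEnergyField ((Φ N).flow 0 z) χ -
        ∫ x, χ x * totalEnergyDensity (ρ 0 x) (u 0 x) (θ 0 x)|}) atTop (nhds 0)) →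
        ∀ t ∈ Set.Ico 0 T, (∀ s ∈ Set.Icc 0 t, ∀ x, ρ s x * σ ^ 3 ≤ η₁ / 2) →
        Tendsto (fun N => P N {z | ∃ r ∈ Set.Icc 0 t, ∃ x : T3,
        η₁ < empiricalDensityField ((Φ N).flow r z)
        (fun y => if Torus.euclidDist x y < (n N : ℝ) ^ (-(1 / 4 : ℝ))
        then (4 / 3 * Real.pi * ((n N : ℝ) ^ (-(1 / 4 : ℝ))) ^ 3)⁻¹ else 0) * σ ^ 3}) atTop (nhds 0) ∧
        (∀ b : ℝ, 0 < b → ∃ A : ℝ, ∀ᶠ N : ℕ in atTop, ∀ s ∈ Set.Icc 0 t,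
        ∫⁻ z, ENNReal.ofReal ((n N : ℝ)⁻¹ * ∑ i : Fin (n N), Real.exp (b * ‖((Φ N).flow s z i).2‖)) ∂(P N) ≤
        ENNReal.ofReal A)) →
    NearConstantShortTimeHL :=
  fun h₁ h₂ h₃ =>
    nearConstantShortTimeHL_of_dynamicsTL (trueLawMomentumClosure_inlined_iff.1 h₁) (trueLawEnergyClosure_inlined_iff.1 h₂)
      (trueLawCapsPE_inlined_iff.1 h₃)

end Summit.AtomisticToContinuum.HydrodynamicLimit.Theorems.NearConstantShortTimeHL

end
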